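import Mathlib
import Summits.NavierStokesRegularity.NavierStokesRegularity.Theorems.FilamentSkeletonRssAnalyticStripLiaSymbolNumericsCert
import Summits.NavierStokesRegularity.NavierStokesRegularity.Theorems.FilamentSkeletonRssTangentSkeletonNearStraightLiaSymbol
import Summits.NavierStokesRegularity.NavierStokesRegularity.Theorems.FilamentSkeletonRssClause13LiaSymbolNegWindowDefs

/-!
# Clause 13-J/13-R, brick B4 (NEGATIVE WINDOW, certified numerics): `𝔖(x) ≤ −1/64` for `1/4 ≤ x ≤ 19/20`

Route `FilamentSkeletonRss`, ∃-side clause 13 (`Clause13RNearStraightL` stmt-NavierStokesRegularity-23612; typing-agnostic); design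
`filament-plan/DESIGN-28296-model-gluing-g16.md` §1/§4 n1a: the window N of the model gluing is where the self symbol `(2/q)𝔖(x)`, `x = z√q`, is
NEGATIVE AND BOUNDED AWAY FROM ZERO, so that the imaginary part of the energy identity (`model_selfForm_bound`, p696039) gives a gain `G(2/q)κ_N`.
This file certifies `κ_N = 1/64` on `x ∈ [1/4, 19/20]` (true values: `𝔖 ≈ −0.031 … −0.0616 … −0.026`), i.e. `Φ(p) ≤ −1/64` for
`p = x²/4 ∈ [0.015, 0.226]`, with the EXISTING kernel-replayable bracket-quadrature machinery of `…AnalyticStripLiaSymbolNumericsDefs/Sound/Cert`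
(p65xxxx, lane g12): `Φ(p) = 1 − C(p) − 2pE(p)`, `C`, `E` antitone, hence on a `p`-cell `[a,b]` `Φ ≤ 1 − C(b) − 2aE(b) ≤ 1 − lowerC(b) − 2a·lowerE(b)`
(lower bracket sums over the 1190-node `t`-grid of record `tdata`, whose well-formedness and `e^{−t}` enclosures are taken from the landed `certificate`).

* §1 soundness of the cell checker `cellOKNeg` / `cellsOKNeg` (definitions and the 149-node `p`-grid in `…Clause13LiaSymbolNegWindowDefs`);
* §2 `certificateNeg` — ONE `native_decide` (`cellsOKNeg (1/64) tdata pgridNeg`; margin ≥ 2·10⁻³ in Φ by a float replay, lane g16 `compute/negwindow2.py`);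
* §3 `Phi_le_neg_window` (`Φ(p) ≤ −1/64` on `[0.015, 0.226]`) and `liaSym_le_neg_window` (`𝔖(x) ≤ −1/64` on `[1/4, 19/20]`, via `liaSym_eq_Phi`).
The neighbouring windows: below, `liaSym_asymp` (p650376…) covers `(0, 0.3]` analytically and the Dirichlet form (p696818) covers `(0, 1/10]`; above, the band
window `[0.9, …]` (Mourre) needs the companion certificate `𝔖′ ≥ σ₀` (n1b, not this file).
Lane ns-filament-19175-p1 g16; `--supports stmt-NavierStokesRegularity-23612 --as helper`; COMPUTATIONAL (one `native_decide`).
HONEST FRAMING: certified numerics for one explicit real integral, serving a HYPOTHETICAL filament-skeleton line on the NEGATIVE side of a MODEL route;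
nothing here bears on Navier–Stokes regularity or blow-up.
-/

set_option linter.dupNamespace false

noncomputable section

namespace Summit.NavierStokesRegularity.NavierStokesRegularity.Theorems.AnalyticStripLiaSymbol

open Real Set MeasureTheory Filter Topology

namespace Numerics

/-! ## §1 The negative-window cell check and its soundness -/

/-- Soundness of one negative-window cell: on `[a,b]`, `Φ ≤ −κ`. -/
theorem cellOKNeg_sound {κ : ℚ} {x : ℚ × ℚ × ℚ} {rest : List (ℚ × ℚ × ℚ)} (hg : gridOK (x :: rest) = true)
    (he : Encl (x :: rest)) {a b : ℚ} (h : cellOKNeg κ (x :: rest) a b = true) :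
    ∀ p : ℝ, (a:ℝ) ≤ p → p ≤ (b:ℝ) → Phi p ≤ -(κ:ℝ) := by
  simp only [cellOKNeg, Bool.and_eq_true, decide_eq_true_eq] at h
  obtain ⟨⟨ha, hab⟩, hup⟩ := h
  have hb : 0 < b := ha.trans_le hab
  intro p hap hpb
  have ha' : (0:ℝ) < a := by exact_mod_cast ha
  have hp : 0 < p := ha'.trans_le hap
  have hup' : (1:ℝ) - (lowerC b (x :: rest) : ℝ) - 2 * (a:ℝ) * (lowerE b (x :: rest) : ℝ) ≤ -(κ:ℝ) := by
    have := (Rat.cast_le (K := ℝ)).mpr hup; push_cast at this; exact this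
  have hC_lo := lowerC_le_Cint hb.le hg he
  have hE_lo := lowerE_le_Eint hb hg he
  have hCb : Cint (b:ℝ) ≤ Cint p := Cint_antitone hp.le hpb
  have hEb : Eint (b:ℝ) ≤ Eint p := Eint_antitone hp hpb
  have hE0 : 0 ≤ Eint (b:ℝ) := Eint_nonneg _
  unfold Phi
  have h1 : (a:ℝ) * Eint (b:ℝ) ≤ p * Eint p := mul_le_mul hap hEb hE0 hp.le
  nlinarith

/-- Soundness of the chained negative-window checks on `[a, last]`. -/
theorem cellsOKNeg_sound {κ : ℚ} {x : ℚ × ℚ × ℚ} {trest : List (ℚ × ℚ × ℚ)} (hg : gridOK (x :: trest) = true)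
    (he : Encl (x :: trest)) :
    ∀ (rest : List ℚ) (a : ℚ), cellsOKNeg κ (x :: trest) (a :: rest) = true → rest ≠ [] →
      ∀ p : ℝ, (a:ℝ) ≤ p → p ≤ (lastQ a rest : ℝ) → Phi p ≤ -(κ:ℝ) := by
  intro rest
  induction rest with
  | nil => intro a _ hne; exact absurd rfl hne
  | cons b rest ih =>
    intro a hc _ p hap hpl
    simp only [cellsOKNeg, Bool.and_eq_true] at hc
    obtain ⟨hcell, hrest⟩ := hc
    by_cases hpb : p ≤ (b:ℝ)
    · exact cellOKNeg_sound hg he hcell p hap hpb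
    · have hbp : (b:ℝ) ≤ p := le_of_lt (not_le.mp hpb)
      cases rest with
      | nil =>
        simp only [lastQ] at hpl
        exact absurd hpl hpb
      | cons c rest' =>
        exact ih b hrest (List.cons_ne_nil _ _) p hbp (by simpa [lastQ] using hpl)

/-! ## §2 The kernel-replayed certificate -/

/-- THE CERTIFICATE for the negative window (the one computational step of this file). -/
theorem certificateNeg :
    (cellsOKNeg (1 / 64) tdata ((15 / 1000 : ℚ) :: pgridNegTail)
      && decide (lastQ (15 / 1000 : ℚ) pgridNegTail = 226 / 1000)) = true := by
  native_decide

/-! ## §3 The real-variable windows -/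

/-- **`Φ(p) ≤ −1/64` for `0.015 ≤ p ≤ 0.226`.** -/
theorem Phi_le_neg_window (p : ℝ) (h1 : 15 / 1000 ≤ p) (h2 : p ≤ 226 / 1000) : Phi p ≤ -(1 / 64) := by
  have hc := certificate
  simp only [Bool.and_eq_true, decide_eq_true_eq] at hc
  obtain ⟨⟨⟨⟨hgrid, hnn⟩, _⟩, _⟩, hne0⟩ := hc
  have hcn := certificateNeg
  simp only [Bool.and_eq_true, decide_eq_true_eq] at hcn
  obtain ⟨hcells, hlast⟩ := hcn
  have htdata : tdata = (tgrid.map fun t => (t, expNegLo t, expNegHi t)) := rfl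
  obtain ⟨x, trest, hx⟩ := List.exists_cons_of_ne_nil hne0
  rw [hx] at hgrid hcells
  have he : Encl (x :: trest) := by rw [← hx, htdata]; exact encl_of_nonneg hnn
  have hne : pgridNegTail ≠ [] := by decide
  have h := cellsOKNeg_sound hgrid he pgridNegTail (15 / 1000) hcells hne p (by push_cast; linarith)
    (by rw [hlast]; push_cast; linarith)
  have e : (((1 / 64 : ℚ) : ℝ)) = 1 / 64 := by norm_num
  rw [e] at h
  exact h

end Numerics

/-- **THE NEGATIVE WINDOW OF THE SELF-INDUCTION SYMBOL: `𝔖(x) ≤ −1/64` for `1/4 ≤ x ≤ 19/20`** (certified numerics; true range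
`−0.031 … −0.0616 … −0.026`). [folklore; kernel-replayed bracket quadrature] -/
theorem liaSym_le_neg_window (x : ℝ) (h1 : 1 / 4 ≤ x) (h2 : x ≤ 19 / 20) : liaSym x ≤ -(1 / 64) := by
  have hx : x ≠ 0 := by intro h; rw [h] at h1; norm_num at h1
  rw [liaSym_eq_Phi x hx]
  refine Numerics.Phi_le_neg_window (x ^ 2 / 4) ?_ ?_
  · nlinarith
  · nlinarith

end Summit.NavierStokesRegularity.NavierStokesRegularity.Theorems.AnalyticStripLiaSymbol

end
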